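import Literature.Analysis.PDE.WeakHarnackSubball
import Literature.MeasureTheory.Covering.KrylovSafonovGrowth
import Mathlib.MeasureTheory.Measure.Haar.InnerProductSpace
import HarnessLib

/-!
# The cube condition of Lemma 9.23 for `w = -log(u + N)` (Gilbarg–Trudinger, proof of Thm 9.22)

We verify the hypothesis `CubeCondition` of the growth lemma
(`Literature.MeasureTheory.Covering.Dyadic.sub_le_of_cube_condition`, GT Lemma 9.23) for the
function `w = -log(u+N)` pulled back to the unit cube of `ι → ℝ` by the chart
`t ↦ (2α t_i - α)_i` onto the cube `K_α(0)` of `EuclideanSpace ℝ ι`: a dyadic sub-cube `Q` of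
generation `j` becomes the cube `K_r(z_Q)`, `r = α 2^{-j}`, and the rescaled, level-shifted
measure-to-supremum step `negLog_le_on_subball` on the ball `B_{2^{-j}}(z_Q) ⊆ B₁` gives
`w ≤ k + C` on `K̄_{3r}(z_Q)` whenever `|{w ≤ k} ∩ Q| ≥ δ|Q|` (`cubeCondition_negLog`). This is
GT's "using the transformation `x → α(x - z)/r` … the estimate (9.56)" with `α < 1/(3√n)`.

## References

* D. Gilbarg, N. S. Trudinger, *Elliptic Partial Differential Equations of Second Order* (2001),
  proof of Theorem 9.22, (9.55)–(9.57). [GilbargTrudinger2001]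
-/

noncomputable section

open Set InnerProductSpace Matrix Filter Metric MeasureTheory WithLp
open scoped Topology ENNReal RealInnerProductSpace

namespace Literature.Analysis.PDE.KrylovSafonov

open Literature.Analysis.PDE.ABP Literature.MeasureTheory.Covering.Dyadic

variable {ι : Type*} [Fintype ι] [DecidableEq ι]

/-! ### The chart from the unit cube onto `K_α(0)` -/

/-- The affine chart `t ↦ (2α t_i - α)_i` from `ι → ℝ` to `EuclideanSpace ℝ ι`; it maps the unit
cube `[0,1)ⁿ` onto the cube `K_α(0) = [-α, α)ⁿ`. [cite: GilbargTrudinger2001, proof of Thm 9.22] -/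
def chart (α : ℝ) (t : ι → ℝ) : EuclideanSpace ℝ ι := toLp 2 (fun i ↦ 2 * α * t i - α)

omit [Fintype ι] [DecidableEq ι] in
/-- Coordinates of the chart. [folklore] -/
@[simp] theorem chart_apply (α : ℝ) (t : ι → ℝ) (i : ι) : (chart α t).ofLp i = 2 * α * t i - α := rfl

omit [Fintype ι] [DecidableEq ι] in
/-- The chart is continuous. [folklore] -/
theorem continuous_chart (α : ℝ) : Continuous (chart (ι := ι) α) := by
  unfold chart; fun_prop

omit [DecidableEq ι] in
/-- **Volume under the chart**: `vol(chart⁻¹ A) = (2α)^{-n} vol(A)`. [folklore] -/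
theorem volume_preimage_chart {α : ℝ} (hα : α ≠ 0) (A : Set (EuclideanSpace ℝ ι)) :
    volume (chart α ⁻¹' A) = ENNReal.ofReal |((2 * α) ^ Fintype.card ι)⁻¹| * volume A := by
  have hset : chart α ⁻¹' A = (fun t : ι → ℝ ↦ (2 * α) • t) ⁻¹'
      ((fun t : ι → ℝ ↦ (fun _ ↦ -α) + t) ⁻¹' ((toLp 2 : (ι → ℝ) → EuclideanSpace ℝ ι) ⁻¹' A)) := by
    ext t
    simp only [mem_preimage]
    have : chart α t = toLp 2 ((fun _ ↦ -α) + (2 * α) • t) := by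
      unfold chart; congr 1; funext i; simp [Pi.add_apply, smul_eq_mul]; ring
    rw [this]
  rw [hset, Measure.addHaar_preimage_smul volume (mul_ne_zero two_ne_zero hα), measure_preimage_add,
    (PiLp.volume_preserving_toLp ι).measure_preimage_emb (MeasurableEquiv.toLp 2 (ι → ℝ)).measurableEmbedding]
  simp

omit [DecidableEq ι] in
/-- The inverse relation `vol(A) = (2α)ⁿ vol(chart⁻¹ A)` for `α > 0`. [folklore] -/
theorem volume_eq_mul_volume_preimage_chart {α : ℝ} (hα : 0 < α) (A : Set (EuclideanSpace ℝ ι)) :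
    volume A = ENNReal.ofReal ((2 * α) ^ Fintype.card ι) * volume (chart α ⁻¹' A) := by
  rw [volume_preimage_chart hα.ne', ← mul_assoc, ← ENNReal.ofReal_mul (by positivity),
    abs_of_pos (by positivity), mul_inv_cancel₀ (by positivity), ENNReal.ofReal_one, one_mul]

omit [DecidableEq ι] in
/-- **Distances under the chart**: `‖chart t - chart c‖ ≤ 2|α| √n R` if `|t_i - c_i| ≤ R` for all
`i`. [folklore] -/
theorem norm_chart_sub_le {α R : ℝ} {t c : ι → ℝ} (hR : 0 ≤ R) (h : ∀ i, |t i - c i| ≤ R) :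
    ‖chart α t - chart α c‖ ≤ 2 * |α| * Real.sqrt (Fintype.card ι) * R := by
  have hsq : ‖chart α t - chart α c‖ ^ 2 ≤ (2 * |α| * Real.sqrt (Fintype.card ι) * R) ^ 2 := by
    rw [EuclideanSpace.norm_eq, Real.sq_sqrt (Finset.sum_nonneg fun i _ ↦ sq_nonneg _)]
    have hterm : ∀ i, ‖(chart α t - chart α c).ofLp i‖ ^ 2 ≤ (2 * |α| * R) ^ 2 := fun i ↦ by
      have e : (chart α t - chart α c).ofLp i = 2 * α * (t i - c i) := by
        simp [chart_apply]; ring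
      rw [e, Real.norm_eq_abs, abs_mul, abs_mul, abs_two]
      have : 2 * |α| * |t i - c i| ≤ 2 * |α| * R := mul_le_mul_of_nonneg_left (h i) (by positivity)
      exact pow_le_pow_left₀ (by positivity) this 2
    calc ∑ i, ‖(chart α t - chart α c).ofLp i‖ ^ 2 ≤ ∑ _i : ι, (2 * |α| * R) ^ 2 :=
          Finset.sum_le_sum fun i _ ↦ hterm i
      _ = Fintype.card ι * (2 * |α| * R) ^ 2 := by simp
      _ = (2 * |α| * Real.sqrt (Fintype.card ι) * R) ^ 2 := by
          rw [mul_pow, mul_pow, mul_pow, mul_pow, mul_pow, Real.sq_sqrt (Nat.cast_nonneg _)]; ring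
  exact (pow_le_pow_iff_left₀ (norm_nonneg _) (by positivity) two_ne_zero).1 hsq

omit [DecidableEq ι] in
/-- A coordinate is bounded by the Euclidean norm. [folklore] -/
theorem abs_ofLp_le_norm (v : EuclideanSpace ℝ ι) (i : ι) : |v.ofLp i| ≤ ‖v‖ := by
  have h : (v.ofLp i) ^ 2 ≤ ‖v‖ ^ 2 := by
    rw [EuclideanSpace.norm_eq, Real.sq_sqrt (Finset.sum_nonneg fun i _ ↦ sq_nonneg _)]
    have : ‖v.ofLp i‖ ^ 2 ≤ ∑ j, ‖v.ofLp j‖ ^ 2 :=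
      Finset.single_le_sum (f := fun j ↦ ‖v.ofLp j‖ ^ 2) (fun j _ ↦ sq_nonneg _) (Finset.mem_univ i)
    simpa [Real.norm_eq_abs, sq_abs] using this
  exact abs_le_of_sq_le_sq' h (norm_nonneg _) |>.2 |> fun h2 ↦ abs_le.2 ⟨(abs_le_of_sq_le_sq' h (norm_nonneg _)).1, h2⟩

/-- **The smallness ratio for cubes**: `θ = min(1/2, θ₀ ω_n/(2α)ⁿ)`, `ω_n = |B₁|`.
[cite: GilbargTrudinger2001, proof of Thm 9.22 (the constant `θ` of (9.55))] -/
def thetaCube (ι : Type*) [Fintype ι] (lam Λ : ℝ) (m : ℕ) (α : ℝ) : ℝ :=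
  min (1 / 2) (thetaZero (Fintype.card ι) lam Λ m α *
    (volume (ball (0 : EuclideanSpace ℝ ι) 1)).toReal / (2 * α) ^ Fintype.card ι)

omit [DecidableEq ι] in
/-- `0 < θ ≤ 1/2`. [folklore] -/
theorem thetaCube_pos [Nonempty ι] {lam Λ : ℝ} (hlam : 0 < lam) (hΛ : 0 ≤ Λ) (m : ℕ) {α : ℝ}
    (hα0 : 0 < α) (hα1 : α ^ 2 < 1) : 0 < thetaCube ι lam Λ m α ∧ thetaCube ι lam Λ m α ≤ 1 / 2 := by
  refine ⟨lt_min (by norm_num) ?_, min_le_left _ _⟩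
  have hω : 0 < (volume (ball (0 : EuclideanSpace ℝ ι) 1)).toReal :=
    ENNReal.toReal_pos (measure_ball_pos volume _ one_pos).ne' measure_ball_lt_top.ne
  have := thetaZero_pos (Fintype.card ι) hlam hΛ m hα1
  positivity

/-- **The cube condition for `w = -log(u+N)`** (GT's (9.57)–(9.58) for the Krylov–Safonov
function): on the unit ball of `EuclideanSpace ℝ ι` (`n = |ι| ≥ 1`), for `u ≥ 0` of class `C²`
with `a^{ij}D_{ij}u ≤ f`, `|f| ≤ N`, `λ ≤ a ≤ Λ`, and `0 < α` with `3α√n < 1`, `nΛ ≤ 2(β-1)λα²`: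
the pull-back of `w` by the chart satisfies `CubeCondition` with `δ = 1 - θ` and
`C = C₁/(1 - 9α²n)^{m+2}`. [cite: GilbargTrudinger2001, proof of Thm 9.22, (9.55)–(9.57)] -/
theorem cubeCondition_negLog [Nonempty ι] {U : Set (EuclideanSpace ℝ ι)} (hU : IsOpen U)
    (hBU : closedBall (0 : EuclideanSpace ℝ ι) 1 ⊆ U) {u f : EuclideanSpace ℝ ι → ℝ} {N : ℝ}
    (hu : ContDiffOn ℝ 2 u U) (hu0 : ∀ y ∈ closedBall (0 : EuclideanSpace ℝ ι) 1, 0 ≤ u y)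
    (hmeas : Measurable u) (hN : 0 < N) (hf : ∀ y ∈ ball (0 : EuclideanSpace ℝ ι) 1, |f y| ≤ N)
    {a : EuclideanSpace ℝ ι → Matrix ι ι ℝ} (ha : ∀ y ∈ ball (0 : EuclideanSpace ℝ ι) 1, (a y).IsSymm)
    {lam Λ : ℝ} (hlam0 : 0 < lam) (hΛ0 : 0 ≤ Λ)
    (hlam : ∀ y ∈ ball (0 : EuclideanSpace ℝ ι) 1, ∀ ξ : ι → ℝ, lam * (ξ ⬝ᵥ ξ) ≤ ξ ⬝ᵥ (a y *ᵥ ξ))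
    (hΛ : ∀ y ∈ ball (0 : EuclideanSpace ℝ ι) 1, ∀ ξ : ι → ℝ, ξ ⬝ᵥ (a y *ᵥ ξ) ≤ Λ * (ξ ⬝ᵥ ξ))
    (hsuper : ∀ y ∈ ball (0 : EuclideanSpace ℝ ι) 1,
      pair (a y) (hessianMatrix u (EuclideanSpace.basisFun ι ℝ) y) ≤ f y)
    {m : ℕ} {α : ℝ} (hα0 : 0 < α) (hρ1 : 3 * α * Real.sqrt (Fintype.card ι) < 1)
    (hβl : Fintype.card ι * Λ ≤ 2 * (((m + 2 : ℕ) : ℝ) - 1) * lam * α ^ 2) :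
    CubeCondition (fun t ↦ -Real.log (u (chart α t) + N)) (1 - thetaCube ι lam Λ m α)
      (supBound (Fintype.card ι) lam Λ m /
        (1 - (3 * α * Real.sqrt (Fintype.card ι)) ^ 2) ^ (m + 2)) := by
  intro k j mIdx hQ hdens x hx
  set n := Fintype.card ι with hn
  set s : ℝ := ((2 : ℝ) ^ j)⁻¹ with hs
  set c := centre j mIdx with hc
  set zQ := chart α c with hzQ
  set ρ := 3 * α * Real.sqrt n with hρ
  set θ := thetaCube ι lam Λ m α with hθ
  set w' : (ι → ℝ) → ℝ := fun t ↦ -Real.log (u (chart α t) + N) with hw'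
  have hn1 : (1 : ℝ) ≤ n := by exact_mod_cast Fintype.card_pos
  have hsqn : 1 ≤ Real.sqrt n := by rw [← Real.sqrt_one]; exact Real.sqrt_le_sqrt hn1
  have hs0 : 0 < s := by positivity
  have hs1 : s ≤ 1 := by rw [hs]; exact inv_le_one_of_one_le₀ (one_le_pow₀ (by norm_num))
  have hαsq : α * Real.sqrt n ≤ 1 := by nlinarith
  have hα1' : α < 1 := by nlinarith
  have hα1 : α ^ 2 < 1 := by nlinarith
  have hρ0 : 0 ≤ ρ := by positivity
  obtain ⟨hθ0, hθhalf⟩ := thetaCube_pos (ι := ι) hlam0 hΛ0 m hα0 hα1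
  -- integrality: `0 ≤ m_i` and `m_i + 1 ≤ 2^j`
  have hcorner : (fun i ↦ (mIdx i : ℝ) / 2 ^ j) ∈ dyadicCube j mIdx := by
    rw [mem_dyadicCube]; intro i
    exact ⟨le_rfl, by
      apply div_lt_div_of_pos_right _ (by positivity); linarith⟩
  have hunit := hQ hcorner
  rw [mem_dyadicCube] at hunit
  have hm0 : ∀ i, (0 : ℝ) ≤ mIdx i := fun i ↦ by
    have := (hunit i).1; simp at this
    have h2 : (0 : ℝ) < 2 ^ j := by positivity
    exact (div_nonneg_iff.1 this).elim (fun h ↦ h.1) (fun h ↦ absurd h.2 (not_le.2 h2))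
  have hm1 : ∀ i, ((mIdx i : ℝ) + 1) / 2 ^ j ≤ 1 := fun i ↦ by
    have := (hunit i).2; simp at this
    have h2 : (0 : ℝ) < 2 ^ j := by positivity
    rw [div_lt_one h2] at this
    have hint : mIdx i + 1 ≤ 2 ^ j := by
      have : (mIdx i : ℝ) < ((2 ^ j : ℤ) : ℝ) := by push_cast; exact this
      have := Int.cast_lt.1 this
      omega
    rw [div_le_one h2]
    exact_mod_cast hint
  -- the centre: `|c_i - 1/2| ≤ (1 - s)/2`
  have hci : ∀ i, |c i - 1 / 2| ≤ (1 - s) / 2 := fun i ↦ by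
    have h2 : (0 : ℝ) < 2 ^ j := by positivity
    have e : c i = ((mIdx i : ℝ) + 1 / 2) / 2 ^ j := rfl
    have lo : s / 2 ≤ c i := by
      rw [e, hs, le_div_iff₀ h2]
      have := hm0 i
      field_simp
      nlinarith
    have hi : c i ≤ 1 - s / 2 := by
      rw [e]
      have := hm1 i
      rw [div_le_one h2] at this
      rw [div_le_iff₀ h2, hs]
      field_simp
      nlinarith
    rw [abs_le]; constructor <;> linarith
  have hchart_half : chart α (fun _ : ι ↦ (1 / 2 : ℝ)) = (0 : EuclideanSpace ℝ ι) := by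
    unfold chart
    have : (fun i : ι ↦ 2 * α * (1 / 2 : ℝ) - α) = 0 := by funext i; simp; ring
    rw [this]; rfl
  have hzQnorm : ‖zQ‖ ≤ α * Real.sqrt n * (1 - s) := by
    have h := norm_chart_sub_le (α := α) (t := c) (c := fun _ ↦ (1 / 2 : ℝ))
      (by linarith : (0 : ℝ) ≤ (1 - s) / 2) hci
    rw [hchart_half, sub_zero, abs_of_pos hα0] at h
    rw [hzQ]; linarith
  have hzs : closedBall zQ s ⊆ closedBall (0 : EuclideanSpace ℝ ι) 1 := by
    intro y hy
    rw [mem_closedBall, dist_eq_norm] at hy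
    rw [mem_closedBall_zero_iff]
    calc ‖y‖ = ‖(y - zQ) + zQ‖ := by rw [sub_add_cancel]
      _ ≤ ‖y - zQ‖ + ‖zQ‖ := norm_add_le _ _
      _ ≤ s + α * Real.sqrt n * (1 - s) := add_le_add hy hzQnorm
      _ ≤ 1 := by nlinarith
  -- measurability of `w'`
  have hw'm : Measurable w' :=
    (Real.measurable_log.comp ((hmeas.comp (continuous_chart α).measurable).add_const N)).neg
  -- the smallness hypothesis on `B_s(zQ)`
  set S : Set (EuclideanSpace ℝ ι) :=
    {y | y ∈ ball zQ s ∧ Real.exp k * (u y + N) < 1} ∩ ball zQ (α * s) with hS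
  have hSsub : chart α ⁻¹' S ⊆ dyadicCube j mIdx ∩ {t | k < w' t} := by
    intro t ht
    obtain ⟨⟨htB, htk⟩, htα⟩ := ht
    have hcoord : ∀ i, |t i - c i| < s / 2 := fun i ↦ by
      have h1 : |(chart α t - zQ).ofLp i| ≤ ‖chart α t - zQ‖ := abs_ofLp_le_norm _ i
      have h2 : ‖chart α t - zQ‖ < α * s := by rwa [mem_ball, dist_eq_norm] at htα
      have e : (chart α t - zQ).ofLp i = 2 * α * (t i - c i) := by
        rw [hzQ]; simp [chart_apply]; ring
      rw [e, abs_mul, abs_mul, abs_two, abs_of_pos hα0] at h1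
      nlinarith
    constructor
    · rw [mem_dyadicCube]; intro i
      have h := hcoord i
      rw [abs_lt] at h
      have e : c i = ((mIdx i : ℝ) + 1 / 2) / 2 ^ j := rfl
      have h2 : (0 : ℝ) < 2 ^ j := by positivity
      have es : s / 2 = (1 / 2) / 2 ^ j := by rw [hs]; field_simp
      constructor
      · have : c i - s / 2 = (mIdx i : ℝ) / 2 ^ j := by rw [e, es]; field_simp; ring
        linarith
      · have : c i + s / 2 = ((mIdx i : ℝ) + 1) / 2 ^ j := by rw [e, es]; field_simp; ring
        linarith
    · show k < w' t
      have hyB : chart α t ∈ closedBall (0 : EuclideanSpace ℝ ι) 1 := hzs (ball_subset_closedBall htB)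
      have hū : 0 < u (chart α t) + N := by linarith [hu0 _ hyB]
      have hlog : Real.log (Real.exp k * (u (chart α t) + N)) < 0 :=
        Real.log_neg (by positivity) htk
      rw [Real.log_mul (Real.exp_pos k).ne' hū.ne', Real.log_exp] at hlog
      show k < -Real.log (u (chart α t) + N)
      linarith
  -- measure of `Q ∩ {k < w'}`
  have hQvol : volume (dyadicCube j mIdx) = ENNReal.ofReal (s ^ n) := by
    rw [volume_dyadicCube, ← ENNReal.ofReal_pow (by positivity)]
  have hQfin : volume (dyadicCube j mIdx) ≠ ∞ := by rw [hQvol]; exact ENNReal.ofReal_ne_top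
  have hTmeas : MeasurableSet {t : ι → ℝ | w' t ≤ k} := hw'm measurableSet_Iic
  have hsplit : volume (dyadicCube j mIdx ∩ {t | k < w' t}) ≤
      ENNReal.ofReal θ * volume (dyadicCube j mIdx) := by
    have hpart := measure_inter_add_sdiff (dyadicCube j mIdx) hTmeas (μ := volume)
    have hdiff : dyadicCube j mIdx \ {t | w' t ≤ k} = dyadicCube j mIdx ∩ {t | k < w' t} := by
      ext t; simp [not_le]
    rw [hdiff] at hpart
    -- `hdens : ofReal (1-θ) vol Q ≤ vol (subLevel ∩ Q) = vol (Q ∩ {w' ≤ k})`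
    have hsl : subLevel w' k ∩ dyadicCube j mIdx = dyadicCube j mIdx ∩ {t | w' t ≤ k} := by
      ext t; simp only [subLevel, mem_inter_iff, mem_setOf_eq]
      constructor
      · rintro ⟨⟨-, h1⟩, h2⟩; exact ⟨h2, h1⟩
      · rintro ⟨h1, h2⟩; exact ⟨⟨hQ h1, h2⟩, h1⟩
    rw [hsl] at hdens
    have hone : ENNReal.ofReal θ + ENNReal.ofReal (1 - θ) = 1 := by
      rw [← ENNReal.ofReal_add hθ0.le (by linarith), add_sub_cancel, ENNReal.ofReal_one]
    have key : volume (dyadicCube j mIdx ∩ {t | k < w' t}) + ENNReal.ofReal (1 - θ) * volume (dyadicCube j mIdx)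
        ≤ ENNReal.ofReal θ * volume (dyadicCube j mIdx) + ENNReal.ofReal (1 - θ) * volume (dyadicCube j mIdx) := by
      calc volume (dyadicCube j mIdx ∩ {t | k < w' t}) + ENNReal.ofReal (1 - θ) * volume (dyadicCube j mIdx)
          ≤ volume (dyadicCube j mIdx ∩ {t | k < w' t}) + volume (dyadicCube j mIdx ∩ {t | w' t ≤ k}) :=
            add_le_add le_rfl hdens
        _ = volume (dyadicCube j mIdx) := by rw [add_comm]; exact hpart
        _ = (ENNReal.ofReal θ + ENNReal.ofReal (1 - θ)) * volume (dyadicCube j mIdx) := by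
            rw [hone, one_mul]
        _ = _ := add_mul _ _ _
    exact (ENNReal.add_le_add_iff_right (ENNReal.mul_ne_top ENNReal.ofReal_ne_top hQfin)).1 key
  have hfinE : Module.finrank ℝ (EuclideanSpace ℝ ι) = n := finrank_euclideanSpace
  have hω0 : volume (ball (0 : EuclideanSpace ℝ ι) 1) ≠ 0 := (measure_ball_pos volume _ one_pos).ne'
  have hωt : volume (ball (0 : EuclideanSpace ℝ ι) 1) ≠ ∞ := measure_ball_lt_top.ne
  have hθsmall : volume S ≤ ENNReal.ofReal (thetaZero n lam Λ m α) * volume (ball zQ s) := by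
    rw [volume_eq_mul_volume_preimage_chart hα0 S, Measure.addHaar_ball volume zQ hs0.le, hfinE]
    set ω := volume (ball (0 : EuclideanSpace ℝ ι) 1) with hω
    calc ENNReal.ofReal ((2 * α) ^ n) * volume (chart α ⁻¹' S)
        ≤ ENNReal.ofReal ((2 * α) ^ n) * (ENNReal.ofReal θ * ENNReal.ofReal (s ^ n)) := by
          refine mul_le_mul_right ?_ _
          rw [← hQvol]
          exact (measure_mono hSsub).trans hsplit
      _ = ENNReal.ofReal ((2 * α) ^ n * θ * s ^ n) := by
          rw [← ENNReal.ofReal_mul hθ0.le, ← ENNReal.ofReal_mul (by positivity), mul_assoc]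
      _ ≤ ENNReal.ofReal (thetaZero n lam Λ m α * s ^ n * ω.toReal) := by
          refine ENNReal.ofReal_le_ofReal ?_
          have hωr : 0 < ω.toReal := ENNReal.toReal_pos hω0 hωt
          have h2α : (0 : ℝ) < (2 * α) ^ n := by positivity
          have hθle : θ ≤ thetaZero n lam Λ m α * ω.toReal / (2 * α) ^ n := min_le_right _ _
          rw [le_div_iff₀ h2α] at hθle
          have hsn : 0 ≤ s ^ n := by positivity
          nlinarith [mul_le_mul_of_nonneg_right hθle hsn]
      _ = ENNReal.ofReal (thetaZero n lam Λ m α) * (ENNReal.ofReal (s ^ n) * ω) := by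
          have hθZ : 0 ≤ thetaZero n lam Λ m α := (thetaZero_pos n hlam0 hΛ0 m hα1).le
          have hθs : 0 ≤ thetaZero n lam Λ m α * s ^ n := mul_nonneg hθZ (by positivity)
          rw [ENNReal.ofReal_mul hθs, ENNReal.ofReal_mul hθZ, ENNReal.ofReal_toReal hωt, mul_assoc]
  -- apply the sub-ball estimate at `y = chart α x`
  have hρ1' : ρ < 1 := hρ1
  have hy : ‖chart α x - zQ‖ ≤ ρ * s := by
    have hxc : ∀ i, |x i - c i| ≤ 3 * (s / 2) := by
      have h := hx.2
      rw [mem_closedBall, dist_pi_le_iff (by positivity)] at h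
      intro i
      have := h i
      rw [Real.dist_eq] at this
      rw [hs]; linarith
    have h := norm_chart_sub_le (α := α) (by positivity : (0 : ℝ) ≤ 3 * (s / 2)) hxc
    rw [abs_of_pos hα0] at h
    rw [hzQ, hρ]; linarith
  have hP := negLog_le_on_subball volume (EuclideanSpace.basisFun ι ℝ) hU hBU hu hu0 hN hf ha hlam0 hΛ0
    hlam hΛ hsuper hα0 hα1 hβl hs0 hs1 hzs k hθsmall hρ0 hρ1' hy
  exact hP

end Literature.Analysis.PDE.KrylovSafonov

end
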